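import Literature.Geometry.Riemannian.RicciFlowSpatialRicciBounds
import Literature.Geometry.Riemannian.RicciFlowShortTimeProofs
import Literature.Geometry.Riemannian.RicciFlowCurvatureDoubling
import Literature.Geometry.Riemannian.CurvatureNormSq
import Literature.Geometry.Riemannian.RicciFlowMaximal
import HarnessLib

/-!
# Point picking at the singular time of a maximal Ricci flow
(stub `stub_pointPicking` of line `margerin-cone-hamilton-rails`, crux
`EntropyRung.ChangGurskyYang`, item stmt-SmoothPoincare4-10834)

Level-2 step of STUB 4 (`stub_pinchedFlowConvergence`) of the line: the POINT PICKING of the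
blow-up at the singular time (Topping 2006, §7.3: "take `pᵢ ∈ M` and `tᵢ ↑ T` such that
`|Rm|(pᵢ, tᵢ) = sup_{x ∈ M, t ∈ [0, tᵢ]} |Rm|(x, t)`", the input of the proof of Thm. 8.5.1;
Hamilton 1995, §16). For a maximal Ricci flow `(g, cov)` on `[0, T)` (`IsMaximalRicciFlow`,
`T < ∞` built in) on a closed connected 4-manifold `M` we produce points `pₙ : M`, times
`tₙ ∈ [T/2, T)` with `tₙ → T`, and scales `Qₙ ≥ 1` with `Qₙ → ∞`, such that
`|Rm|²(pₙ, tₙ) = Qₙ²` is the MAXIMUM of `|Rm|²` over `M × [0, tₙ]`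
(`|Rm|² = PseudoRiemannianMetric.curvNormSqWith`, `CurvatureNormSq.lean`).

## Proof (fact-free)

Write `u(x, t) = |Rm|²_{g(t)}(x)`.
* `u` is jointly continuous on `M × [0, τ]` for every `0 < τ < T`: restrict the flow to `[0, τ]`
  (`IsRicciFlow.mono`) and use `IsRicciFlow.contMDiffOn_curvNormSqWith` with the chart families
  `IsRicciFlow.isMetricFamilyOn_chartRep … |>.contDiffOn_rmNormSqAt_family`
  (`pointPicking_continuousOn`); hence `u` attains its maximum on the compact `M × [0, τ]`
  (`IsCompact.exists_isMaxOn`; `pointPicking_exists_max`).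
* Curvature blow-up (Topping 2006, Thm. 5.3.1, a THEOREM of the tree:
  `ricciFlow_curvature_blowup_of_shortTime ricciFlow_shortTime_existence_holds`): for every `C`
  the frame bound `CurvatureBoundedBy (g t) (cov t) C` fails at some `t ∈ [0, T)`; failure of the
  frame bound `√L` gives a point with `u > L` (contrapositive of
  `curvatureBoundedBy_of_curvNormSqWith_le`; `pointPicking_exists_lt`).
* One index (`pointPicking_step`): given a barrier `σ ∈ (0, T)` and a level `L`, let `B` be the
  maximum of `u` on `M × [0, σ]` and `L' = max L B + 1`; blow-up gives `(x₀, t₀)` with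
  `u(x₀, t₀) > L'`, so `t₀ > σ`; the maximum point `(p, t)` of `u` on `M × [0, t₀]` has
  `u(p, t) ≥ u(x₀, t₀) > L' > B`, whence `t > σ`, `u(p, t) ≥ L`, and `(p, t)` maximises `u` on
  `M × [0, t] ⊆ M × [0, t₀]`.
* The stub: barriers `σₙ = T − T/(n+2) ∈ [T/2, T)`, `σₙ → T`, levels `Lₙ = n + 1`,
  `Qₙ = √(u(pₙ, tₙ))`; then `tₙ → T` by squeezing, `Qₙ ≥ 1`, `Qₙ → ∞` (`Real.tendsto_sqrt_atTop`),
  `Qₙ² = u(pₙ, tₙ)` (`Real.sq_sqrt`, `curvNormSqWith_nonneg`).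

No definition, no named fact is introduced; the blow-up theorem and short-time existence are
proved in the tree.

## References

* P. Topping, *Lectures on the Ricci flow*, LMS Lecture Note Series 325, CUP 2006, §7.3 (p. 87)
  and §8.5, proof of Thm. 8.5.1; Thm. 5.3.1. [Topping2006]
* R. S. Hamilton, *The formation of singularities in the Ricci flow*, Surveys in Differential
  Geometry II, International Press 1995, 7–136, §16. [Hamilton1995]
-/

noncomputable section

-- every `Summit.SmoothPoincare4.SmoothPoincare4.…` name repeats the summit = sub-problem segment (D-0017 layout)
set_option linter.dupNamespace false

open Set Function Filter
open scoped Manifold ContDiff Topology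

namespace Summit.SmoothPoincare4.SmoothPoincare4.Theorems.MargerinRails

open Literature.Geometry.Riemannian
open Literature.Geometry.Lorentzian Literature.Geometry.Lorentzian.PseudoRiemannianMetric

section General

variable {E : Type*} [NormedAddCommGroup E] [NormedSpace ℝ E] [FiniteDimensional ℝ E]
  [CompleteSpace E] {H : Type*} [TopologicalSpace H] {I : ModelWithCorners ℝ E H} [I.Boundaryless]
  {M : Type*} [TopologicalSpace M] [ChartedSpace H M] [IsManifold I ∞ M]
  {g : ℝ → PseudoRiemannianMetric I ∞ E (TangentSpace I : M → Type _)}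
  {cov : ℝ → CovariantDerivative I E (TangentSpace I : M → Type _)} {T : ℝ}

/-- **`|Rm|²` is jointly continuous on `M × [0, τ]` along a Ricci flow on `[0, T)`, `0 < τ < T`**
(Topping 2006, §1.2.3: the curvature of a smooth family is smooth on space-time): the flow
restricted to `[0, τ]` has jointly `C^∞` chart families, so `IsRicciFlow.contMDiffOn_curvNormSqWith`
applies. [cite: Topping2006, §1.2.3] -/
theorem pointPicking_continuousOn (hflow : IsRicciFlow g cov (Ico 0 T)) {τ : ℝ} (hτ : 0 < τ)
    (hτT : τ < T) :
    ContinuousOn (fun q : M × ℝ ↦ (g q.2).curvNormSqWith (cov q.2) q.1) (univ ×ˢ Icc 0 τ) := by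
  have hflow' : IsRicciFlow g cov (Icc 0 τ) := hflow.mono (Icc_subset_Ico_right hτT)
  exact (hflow'.contMDiffOn_curvNormSqWith fun z ↦
    (hflow'.isMetricFamilyOn_chartRep hτ z).contDiffOn_rmNormSqAt_family).continuousOn

/-- **`|Rm|²` attains its maximum on `M × [0, τ]`** (`M` compact nonempty, `0 < τ < T`): the extreme
value theorem for the jointly continuous `|Rm|²` on the compact `M × [0, τ]`. [folklore] -/
theorem pointPicking_exists_max [CompactSpace M] [Nonempty M] (hflow : IsRicciFlow g cov (Ico 0 T))
    {τ : ℝ} (hτ : 0 < τ) (hτT : τ < T) :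
    ∃ (p : M) (t : ℝ), t ∈ Icc 0 τ ∧ ∀ s ∈ Icc 0 τ, ∀ x : M,
      (g s).curvNormSqWith (cov s) x ≤ (g t).curvNormSqWith (cov t) p := by
  have hK : IsCompact ((univ : Set M) ×ˢ Icc (0 : ℝ) τ) := isCompact_univ.prod isCompact_Icc
  have hne : ((univ : Set M) ×ˢ Icc (0 : ℝ) τ).Nonempty :=
    ⟨(Classical.arbitrary M, 0), mem_univ _, le_rfl, hτ.le⟩
  obtain ⟨⟨p, t⟩, ⟨-, ht⟩, hmx⟩ :=
    hK.exists_isMaxOn hne (pointPicking_continuousOn hflow hτ hτT)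
  exact ⟨p, t, ht, fun s hs x ↦ (isMaxOn_iff.mp hmx) (x, s) ⟨mem_univ x, hs⟩⟩

/-- **Failure of the frame bound `√L` produces a point with `|Rm|² > L`** (contrapositive of
`curvatureBoundedBy_of_curvNormSqWith_le`: `|Rm|² ≤ L` everywhere gives the frame bound `√L`;
Topping 2006, p. 37: `|Rm|` is comparable to the largest sectional curvature).
[cite: Topping2006, §3.2, p. 37] -/
theorem pointPicking_exists_lt {g₁ : PseudoRiemannianMetric I ∞ E (TangentSpace I : M → Type _)}
    {cov₁ : CovariantDerivative I E (TangentSpace I : M → Type _)} (hR : g₁.IsRiemannian)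
    (hLC : g₁.IsLeviCivita cov₁) {L : ℝ} (h : ¬ CurvatureBoundedBy g₁ cov₁ (Real.sqrt L)) :
    ∃ x : M, L < g₁.curvNormSqWith cov₁ x := by
  by_contra hcon
  exact h (curvatureBoundedBy_of_curvNormSqWith_le hR hLC fun x ↦ not_lt.mp fun hx ↦ hcon ⟨x, hx⟩)

/-- **Point picking, one index** (Topping 2006, §7.3; Hamilton 1995, §16). For a maximal Ricci flow
on `[0, T)` on a compact manifold whose curvature blows up at `T` (`hblow`, the conclusion of
`ricciFlow_curvature_blowup`), a barrier `σ ∈ (0, T)` and a level `L`: there is a space-time point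
`(p, t)`, `σ < t < T`, with `|Rm|²(p, t) ≥ L` maximal over `M × [0, t]`. Proof: `B :=` the maximum on
`M × [0, σ]`, `L' := max L B + 1`; blow-up gives a value `> L'` at a time `t₀`, necessarily `> σ`;
the maximum point of `|Rm|²` on `M × [0, t₀]` does it. [cite: Topping2006, §7.3]
[cite: Hamilton1995, §16] -/
theorem pointPicking_step [CompactSpace M] [Nonempty M] (hmax : IsMaximalRicciFlow g cov T)
    (hblow : ∀ C : ℝ, ∃ t₀ ∈ Ico 0 T, ∀ t ∈ Ico t₀ T, ¬ CurvatureBoundedBy (g t) (cov t) C)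
    {σ : ℝ} (hσ : 0 < σ) (hσT : σ < T) (L : ℝ) :
    ∃ (p : M) (t : ℝ), t ∈ Ico 0 T ∧ σ < t ∧ L ≤ (g t).curvNormSqWith (cov t) p ∧
      ∀ s ∈ Icc 0 t, ∀ x : M,
        (g s).curvNormSqWith (cov s) x ≤ (g t).curvNormSqWith (cov t) p := by
  -- a bound `B` on `M × [0, σ]`
  obtain ⟨p₀, s₀, -, hB⟩ := pointPicking_exists_max hmax.isRicciFlow hσ hσT
  set B := (g s₀).curvNormSqWith (cov s₀) p₀ with hBdef
  -- the auxiliary level `L' := max L B + 1`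
  set L' := max L B + 1 with hL'def
  have hL'B : B < L' := by rw [hL'def]; linarith [le_max_right L B]
  have hL'L : L ≤ L' := by rw [hL'def]; linarith [le_max_left L B]
  -- blow-up: the frame bound `√L'` fails at some `t₀ ∈ [0, T)`, hence a value `> L'` at `t₀`
  obtain ⟨t₀, ht₀, hviol⟩ := hblow (Real.sqrt L')
  have hnot : ¬ CurvatureBoundedBy (g t₀) (cov t₀) (Real.sqrt L') := hviol t₀ ⟨le_rfl, ht₀.2⟩
  obtain ⟨x₀, hx₀⟩ := pointPicking_exists_lt (hmax.isRiemannian t₀ ht₀)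
    (hmax.isRicciFlow.isLeviCivita t₀ ht₀) hnot
  -- `σ < t₀`, for on `M × [0, σ]` the values are `≤ B < L'`
  have ht₀σ : σ < t₀ := by
    refine not_le.mp fun hle ↦ ?_
    have := hB t₀ ⟨ht₀.1, hle⟩ x₀
    linarith
  have ht₀pos : 0 < t₀ := hσ.trans ht₀σ
  -- the maximum of `|Rm|²` over `M × [0, t₀]`
  obtain ⟨p, t, ht, hmx⟩ := pointPicking_exists_max hmax.isRicciFlow ht₀pos ht₀.2
  have hval : L' < (g t).curvNormSqWith (cov t) p :=
    hx₀.trans_le (hmx t₀ ⟨ht₀.1, le_rfl⟩ x₀)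
  refine ⟨p, t, ⟨ht.1, ht.2.trans_lt ht₀.2⟩, ?_, hL'L.trans hval.le,
    fun s hs x ↦ hmx s ⟨hs.1, hs.2.trans ht.2⟩ x⟩
  -- `σ < t`, for the same reason
  refine not_le.mp fun hle ↦ ?_
  have := hB t ⟨ht.1, hle⟩ p
  linarith

end General

/-- **STUB — TOPPING'S POINT PICKING AT THE SINGULAR TIME** (Topping 2006, §7.3 and the proof of
Thm. 8.5.1; Hamilton 1995, §16). For a maximal Ricci flow `(g, cov)` on `[0, T)` on a closed
connected 4-manifold there are `pₙ : M`, `tₙ ∈ [0, T)` with `tₙ ≥ T/2`, `tₙ → T`, and `Qₙ ≥ 1` with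
`Qₙ → ∞`, such that `|Rm|²(pₙ, tₙ) = Qₙ²` and `|Rm|²(x, s) ≤ Qₙ²` for all `x : M`, `s ∈ [0, tₙ]`.
Proof: curvature blow-up (Topping 2006, Thm. 5.3.1 = tree theorem
`ricciFlow_curvature_blowup_of_shortTime ricciFlow_shortTime_existence_holds`) and
`pointPicking_step` with barriers `σₙ = T − T/(n+2)` and levels `n + 1`; `Qₙ := √(|Rm|²(pₙ, tₙ))`.
[cite: Topping2006, §7.3] [cite: Hamilton1995, §16] -/
theorem stub_pointPicking :
    ∀ (M : Type) [TopologicalSpace M] [T2Space M] [SecondCountableTopology M]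
      [ChartedSpace (EuclideanSpace ℝ (Fin 4)) M] [IsManifold (𝓡 4) ∞ M] [CompactSpace M]
      [ConnectedSpace M]
      (g : ℝ → PseudoRiemannianMetric (𝓡 4) ∞ (EuclideanSpace ℝ (Fin 4)) (TangentSpace (𝓡 4) : M → Type _))
      (cov : ℝ → CovariantDerivative (𝓡 4) (EuclideanSpace ℝ (Fin 4)) (TangentSpace (𝓡 4) : M → Type _))
      (T : ℝ), IsMaximalRicciFlow g cov T →
      ∃ (p : ℕ → M) (t : ℕ → ℝ) (Q : ℕ → ℝ),
        (∀ n, t n ∈ Ico 0 T) ∧ Tendsto t atTop (𝓝 T) ∧ (∀ n, 1 ≤ Q n) ∧ Tendsto Q atTop atTop ∧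
        (∀ n, T / 2 ≤ t n) ∧
        (∀ n, (g (t n)).curvNormSqWith (cov (t n)) (p n) = Q n ^ 2) ∧
        (∀ n, ∀ s ∈ Icc 0 (t n), ∀ x : M, (g s).curvNormSqWith (cov s) x ≤ Q n ^ 2) := by
  intro M _ _ _ _ _ _ _ g cov T hmax
  have hT : 0 < T := hmax.pos
  have hblow := ricciFlow_curvature_blowup_of_shortTime ricciFlow_shortTime_existence_holds
    (𝓡 4) M T g cov hmax
  -- the barriers `σ n = T − T/(n+2) ∈ [T/2, T)`, `σ n → T`
  set σ : ℕ → ℝ := fun n ↦ T - T / ((n : ℝ) + 2) with hσdef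
  have hσpos : ∀ n : ℕ, 0 < T / ((n : ℝ) + 2) := fun n ↦ by positivity
  have hσhalf : ∀ n, T / 2 ≤ σ n := by
    intro n
    have h : T / ((n : ℝ) + 2) ≤ T / 2 :=
      div_le_div_of_nonneg_left hT.le (by norm_num) (by linarith [(n.cast_nonneg : (0 : ℝ) ≤ n)])
    simp only [hσdef]
    linarith
  have hσ0 : ∀ n, 0 < σ n := fun n ↦ (half_pos hT).trans_le (hσhalf n)
  have hσT : ∀ n, σ n < T := fun n ↦ by simp only [hσdef]; linarith [hσpos n]
  have hσlim : Tendsto σ atTop (𝓝 T) := by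
    have h1 : Tendsto (fun n : ℕ ↦ (n : ℝ) + 2) atTop atTop :=
      tendsto_atTop_mono (fun n ↦ by linarith) tendsto_natCast_atTop_atTop
    have h2 : Tendsto (fun n : ℕ ↦ T / ((n : ℝ) + 2)) atTop (𝓝 0) :=
      tendsto_const_nhds.div_atTop h1
    have h3 := (tendsto_const_nhds (x := T) (f := (atTop : Filter ℕ))).sub h2
    rwa [sub_zero] at h3
  -- pick one space-time point per index
  choose p t ht hσt hL hmx using fun n : ℕ ↦
    pointPicking_step hmax hblow (hσ0 n) (hσT n) ((n : ℝ) + 1)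
  have hnn : ∀ n, 0 ≤ (g (t n)).curvNormSqWith (cov (t n)) (p n) := fun n ↦
    curvNormSqWith_nonneg (hmax.isRiemannian _ (ht n)) (hmax.isRicciFlow.isLeviCivita _ (ht n)) _
  refine ⟨p, t, fun n ↦ Real.sqrt ((g (t n)).curvNormSqWith (cov (t n)) (p n)), ht, ?_, ?_, ?_,
    fun n ↦ (hσhalf n).trans (hσt n).le, fun n ↦ (Real.sq_sqrt (hnn n)).symm, ?_⟩
  · -- `t n → T`, squeezed between `σ n → T` and `T`
    exact tendsto_of_tendsto_of_tendsto_of_le_of_le hσlim tendsto_const_nhds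
      (fun n ↦ (hσt n).le) (fun n ↦ (ht n).2.le)
  · -- `1 ≤ Q n`
    intro n
    exact Real.one_le_sqrt.2 (by linarith [hL n, (n.cast_nonneg : (0 : ℝ) ≤ n)])
  · -- `Q n → ∞`
    refine Real.tendsto_sqrt_atTop.comp ?_
    refine tendsto_atTop_mono (fun n ↦ hL n) ?_
    exact tendsto_atTop_mono (fun n ↦ by linarith) tendsto_natCast_atTop_atTop
  · -- maximality over `M × [0, t n]`
    intro n s hs x
    rw [Real.sq_sqrt (hnn n)]
    exact hmx n s hs x

end Summit.SmoothPoincare4.SmoothPoincare4.Theorems.MargerinRails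

end
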